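import Summits.KontsevichZagierPeriods.Zeta5Search.Barrier.ConeGammaLemmaFWinSound

/-!
# ζ(5) search — BARRIER: kernel enclosures of the WINDOWED Lemma F bound with members — SOUNDNESS, part 2
# (the window recursion, the first-wall condition, and the final theorems `Φ ≤ s₀·β` from a certificate)

HONEST FRAMING (cell `pub-zeta5`): systematic search; no irrationality claim unless kernel-certified. Kernel ARITHMETIC
about the explicit real expression `winForm` (= the right-hand side of P2 g24's `phi30_le_windows_members`, VERBATIM, file
`ConeGammaLemmaFWin`); the passage to `Φ = phi30` is P2 g24's theorem (cert-2 g33's KERNEL 42-family underneath) at the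
normalised direction plus homogeneity `phi30_smul`. MODEL-side objects under BZ (28)+(30) ((28) observed, not proved).
Nothing here is about C₀ / C₁ / δ₂₈ — so NO γ-statement anywhere —, any γ of record, the cone's sup, C2 (OPEN),
S-E (CONJECTURED), (TD_A) or `ζ(5)`; records in print UNMOVED. Theory seat cert-2 g35 (item «WINDOWED LEMMA F NUMERICS IN THE
KERNEL — POINTS»), part 2b.

* `winFormL`, `winFormL_eq_winForm` — the list recursion of the checker is the `Finset.range` sum of P2's bound;
* `winSum_sound` — the computable window sum encloses it (finite windows through `jWinEnc`, the tail through `jTailEnc`);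
* `h28_aOfS_mul`, `hh_of_wallOK` — the 28 first-wall inequalities `U₀·h_k ≤ 1` from the integer check;
* **`phi30_aOfS_le_winForm_of_winEnc`**, **`winForm_mem_of_winEnc`** — what a successful `winEnc` certifies;
* **`phi30_aOfS_le_of_winCheck`**, **`winForm_mem_of_winCheck2`**, **`phi30_le_of_winCheck`**, **`phi30_le_of_winCheck2`**
  — `winCheck … p q = true ⇒ Φ(a) ≤ s₀(a)·(p/q)` for EVERY direction `a` of the closed box whose normalised parameters are
  `s_i(a)/s₀(a) = pt_i/D`; the two-sided check gives the KERNEL INTERVAL `pl/q ≤ winForm ≤ pu/q` as well.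
-/

open Finset Set MeasureTheory
open Literature.Analysis.ValidatedNumerics.NumericsMP

namespace Summit.KontsevichZagierPeriods.Zeta5Search.Barrier.ConeGamma

namespace LemmaFWin

open LemmaFBox (SC lnNat SC_pos aOfS_normalise)

/-! ### The window recursion -/

/-- Real-side mirror of `winSum`: P2's bound assembled along the cut / member lists. -/
noncomputable def winFormL (s : Fin 8 → ℝ) (E : ℕ) : List ℕ → List (Fin 7 × Fin 7) → ℝ
  | [A], [vw] => memC s vw.1 vw.2 / ((A : ℝ) / E) - memT s vw.1 vw.2 ((A : ℝ) / E)
  | A :: A' :: As, vw :: vws =>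
      (memC s vw.1 vw.2 * (1 / ((A : ℝ) / E) - 1 / ((A' : ℝ) / E))
        - (memT s vw.1 vw.2 ((A : ℝ) / E) - memT s vw.1 vw.2 ((A' : ℝ) / E)))
      + winFormL s E (A' :: As) vws
  | _, _ => 0

/-- The list recursion is P2's `Finset.range` sum with `U_w = cuts_w/E`, `(p_w, q_w) = mems_w`, `W = #cuts − 1`. -/
theorem winFormL_eq_winForm (s : Fin 8 → ℝ) (E : ℕ) :
    ∀ (n : ℕ) (cuts : List ℕ) (mems : List (Fin 7 × Fin 7)), cuts.length = n + 1 → mems.length = n + 1 →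
      winFormL s E cuts mems = winForm s n (fun w => ((cuts.getD w 0 : ℕ) : ℝ) / E)
        (fun w => (mems.getD w (0, 1)).1) (fun w => (mems.getD w (0, 1)).2)
  | 0, [A], [vw], _, _ => by simp [winFormL, winForm]
  | 0, [], _, h, _ => by simp at h
  | 0, _ :: _ :: _, _, h, _ => by simp at h
  | 0, [_], [], _, h => by simp at h
  | 0, [_], _ :: _ :: _, _, h => by simp at h
  | _ + 1, [], _, h, _ => by simp at h
  | _ + 1, [_], _, h, _ => by simp at h
  | _ + 1, _ :: _ :: _, [], _, h => by simp at h
  | n + 1, A :: A' :: As, vw :: vws, hc, hm => by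
    have hc' : (A' :: As).length = n + 1 := by simpa using hc
    have hm' : vws.length = n + 1 := by simpa using hm
    simp only [winFormL]
    rw [winFormL_eq_winForm s E n (A' :: As) vws hc' hm']
    simp only [winForm, Finset.sum_range_succ', List.getD_cons_succ, List.getD_cons_zero]
    ring

/-- `memShapeAll` with the trivial predicate. -/
theorem memShapeAll_true (pt : List ℕ) (v w : Fin 7) : memShapeAll pt v w (fun _ => true) = true := by
  simp [memShapeAll, all7]

/-- The tail member of a list with at least two entries is the tail member of its tail. -/
theorem lastMem_cons (vw x : Fin 7 × Fin 7) (xs : List (Fin 7 × Fin 7)) :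
    lastMem (vw :: x :: xs) = lastMem (x :: xs) := by
  simp [lastMem]

/-- **Soundness of the window sum**: it encloses `winFormL` (finite windows via `jWinEnc_sound`, the tail via
`jTailEnc_sound`). -/
theorem winSum_sound {D E : ℕ} (hD : 0 < D) (hE : 0 < E) {pt : List ℕ} {s : Fin 8 → ℝ}
    (ht : ∀ i : Fin 8, s i * D = ((pt.getD i 0 : ℕ) : ℝ)) (h0 : pt.getD 0 0 = D)
    (hle : ∀ i : Fin 8, pt.getD i 0 ≤ D) {LD : MI} (hLD : MI.mem SC (Real.log D) LD) :
    ∀ (cuts : List ℕ) (mems : List (Fin 7 × Fin 7)), sortedLE cuts = true → 0 < cuts.getD 0 0 →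
      cuts.length = mems.length → memShapeAll pt (lastMem mems).1 (lastMem mems).2 tailPred = true →
      MI.mem SC (winFormL s E cuts mems) (winSum pt D E LD cuts mems)
  | [], _, _, hA, _, _ => by simp at hA
  | [_], [], _, _, hlen, _ => by simp at hlen
  | [_], _ :: _ :: _, _, _, hlen, _ => by simp at hlen
  | _ :: _ :: _, [], _, _, hlen, _ => by simp at hlen
  | [A], [vw], _, hA, _, hall => by
    have hA : 0 < A := by simpa using hA
    have hlast : lastMem [vw] = vw := by simp [lastMem]
    rw [hlast] at hall
    simp only [winFormL, winSum, tailTerm]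
    refine MI.mem_sub ?_ ?_
    · rw [memC_eq_cnt hD ht]
      have h := MI.mem_ofFrac SC ((cnt pt vw.1 vw.2 * E : ℕ) : ℤ) hA
      convert h using 1
      have hA' : (A : ℝ) ≠ 0 := by positivity
      have hE' : (E : ℝ) ≠ 0 := by positivity
      push_cast; field_simp
    · rw [memT_eq_memShape]
      exact memShapeEnc_sound hD ht h0 hle vw.1 vw.2 (fun X hX hp => jTailEnc_sound hD hE hA hLD hX hp) hall
  | A :: A' :: As, vw :: vws, hsort, hA, hlen, hall => by
    have hA : 0 < A := by simpa using hA
    simp only [sortedLE, Bool.and_eq_true, decide_eq_true_eq] at hsort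
    obtain ⟨hAA', hsort'⟩ := hsort
    have hA'0 : 0 < A' := lt_of_lt_of_le hA hAA'
    have hlen' : (A' :: As).length = vws.length := by simpa using hlen
    have hlast : lastMem (vw :: vws) = lastMem vws := by
      cases vws with
      | nil => simp at hlen'
      | cons x xs => exact lastMem_cons vw x xs
    rw [hlast] at hall
    have IH := winSum_sound hD hE ht h0 hle hLD (A' :: As) vws hsort' (by simpa using hA'0) hlen' hall
    simp only [winFormL, winSum, winTerm]
    refine MI.mem_add (MI.mem_sub ?_ ?_) IH
    · rw [memC_eq_cnt hD ht]
      have h := MI.mem_sub (MI.mem_ofFrac SC ((cnt pt vw.1 vw.2 * E : ℕ) : ℤ) hA)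
        (MI.mem_ofFrac SC ((cnt pt vw.1 vw.2 * E : ℕ) : ℤ) hA'0)
      convert h using 1
      have hA1 : (A : ℝ) ≠ 0 := by positivity
      have hA2 : (A' : ℝ) ≠ 0 := by positivity
      have hE' : (E : ℝ) ≠ 0 := by positivity
      push_cast; field_simp
    · rw [memT_eq_memShape, memT_eq_memShape, memShape_sub]
      exact memShapeEnc_sound hD ht h0 hle vw.1 vw.2 (pr := fun _ => true)
        (fun X hX _ => jWinEnc_sound hD hE hA hAA' (deltaE_sound hE hA hAA') hX) (memShapeAll_true pt vw.1 vw.2)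

/-! ### The first-wall condition -/

/-- The 28 forms at `s = pt/D`, scaled by `D`, are the integers `wallNum pt (wallForm k)`. -/
theorem h28_aOfS_mul {D : ℕ} {pt : List ℕ} {s : Fin 8 → ℝ} (ht : ∀ i : Fin 8, s i * D = ((pt.getD i 0 : ℕ) : ℝ))
    (k : Fin 28) : h28 (aOfS s) k * D = (wallNum pt (wallForm k) : ℝ) := by
  have h8 : ∀ i : Fin 8, s i * D = ((pt.getD i 0 : ℕ) : ℝ) := ht
  rw [h28_aOfS]
  fin_cases k <;> simp [wallForm, wallNum, Pz, add_mul, sub_mul, h8]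

/-- What `wallOK` certifies: `U₀ · h_k(aOfS s) ≤ 1` for all 28 forms, `U₀ = A₀/E`. -/
theorem hh_of_wallOK {D E A0 : ℕ} (hD : 0 < D) (hE : 0 < E) {pt : List ℕ} {s : Fin 8 → ℝ}
    (ht : ∀ i : Fin 8, s i * D = ((pt.getD i 0 : ℕ) : ℝ)) (hw : wallOK pt E A0 D = true) (k : Fin 28) :
    (A0 : ℝ) / E * h28 (aOfS s) k ≤ 1 := by
  simp only [wallOK, List.all_eq_true, List.mem_finRange, decide_eq_true_eq, true_implies] at hw
  have hk : ((A0 : ℤ) : ℝ) * (wallNum pt (wallForm k) : ℝ) ≤ (((E * D : ℕ) : ℤ) : ℝ) := by exact_mod_cast hw k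
  push_cast at hk
  have hD' : (0 : ℝ) < D := by exact_mod_cast hD
  have hE' : (0 : ℝ) < E := by exact_mod_cast hE
  rw [div_mul_eq_mul_div, div_le_one hE']
  refine le_of_mul_le_mul_right ?_ hD'
  rw [mul_assoc, h28_aOfS_mul ht k]
  exact hk

/-! ### What the data checks certify -/

/-- `ptOK`: `D > 0`, `pt₀ = D`, `pt_i ≤ D`. -/
theorem ptOK_spec {pt : List ℕ} {D : ℕ} (h : ptOK pt D = true) :
    0 < D ∧ pt.getD 0 0 = D ∧ ∀ i : Fin 8, pt.getD i 0 ≤ D := by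
  simp only [ptOK, Bool.and_eq_true, decide_eq_true_eq, List.all_eq_true, List.mem_range] at h
  exact ⟨h.1.1, h.1.2, fun i => h.2 i i.isLt⟩

/-- `sortedLE`: consecutive entries are ordered. -/
theorem sortedLE_spec : ∀ (l : List ℕ), sortedLE l = true → ∀ w, w + 1 < l.length → l.getD w 0 ≤ l.getD (w + 1) 0
  | [], _, w, hw => by simp at hw
  | [_], _, w, hw => by simp at hw
  | a :: b :: l, h, w, hw => by
    simp only [sortedLE, Bool.and_eq_true, decide_eq_true_eq] at h
    cases w with
    | zero => simpa using h.1
    | succ w =>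
      simp only [List.getD_cons_succ]
      exact sortedLE_spec (b :: l) h.2 w (by simpa using hw)

/-- Members of the list have `v ≠ w`. -/
theorem mems_spec {mems : List (Fin 7 × Fin 7)} (h : (mems.all fun vw => decide (vw.1 ≠ vw.2)) = true)
    {w : ℕ} (hw : w < mems.length) : (mems.getD w (0, 1)).1 ≠ (mems.getD w (0, 1)).2 := by
  simp only [List.all_eq_true, decide_eq_true_eq] at h
  rw [List.getD_eq_getElem _ _ hw]
  exact h _ (List.getElem_mem hw)

/-- **What a successful `winEnc` certifies**: (1) P2's hypotheses hold at `s = pt/D` with the cuts `cuts/E` and the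
members `mems`, so `Φ(aOfS s) ≤ winForm …`; (2) the returned interval encloses `winForm …`. -/
theorem winEnc_sound {pt : List ℕ} {D E : ℕ} {cuts : List ℕ} {mems : List (Fin 7 × Fin 7)} {I : MI}
    (h : winEnc pt D E cuts mems = some I) {s : Fin 8 → ℝ}
    (ht : ∀ i : Fin 8, s i * D = ((pt.getD i 0 : ℕ) : ℝ)) :
    phi30 (aOfS s) ≤ winForm s (cuts.length - 1) (fun w => ((cuts.getD w 0 : ℕ) : ℝ) / E)
        (fun w => (mems.getD w (0, 1)).1) (fun w => (mems.getD w (0, 1)).2) ∧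
      MI.mem SC (winForm s (cuts.length - 1) (fun w => ((cuts.getD w 0 : ℕ) : ℝ) / E)
        (fun w => (mems.getD w (0, 1)).1) (fun w => (mems.getD w (0, 1)).2)) I := by
  unfold winEnc at h
  by_cases hchk : (ptOK pt D && cutsOK E cuts mems && wallOK pt E (cuts.getD 0 0) D) = true
  · rw [if_pos hchk] at h
    split at h
    · simp at h
    rename_i LD hLD
    by_cases hall : memShapeAll pt (lastMem mems).1 (lastMem mems).2 tailPred = true
    · rw [if_pos hall] at h
      simp only [Option.some.injEq] at h
      subst h
      simp only [Bool.and_eq_true] at hchk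
      obtain ⟨⟨hpt, hcuts⟩, hw⟩ := hchk
      obtain ⟨hD, h0, hle⟩ := ptOK_spec hpt
      simp only [cutsOK, Bool.and_eq_true, decide_eq_true_eq] at hcuts
      obtain ⟨⟨⟨⟨⟨hE, hA0⟩, hsort⟩, hlen⟩, hlenpos⟩, hmems⟩ := hcuts
      have hD' : (0 : ℝ) < D := by exact_mod_cast hD
      have hE' : (0 : ℝ) < E := by exact_mod_cast hE
      have hcl : cuts.length = (cuts.length - 1) + 1 := by omega
      have hml : mems.length = (cuts.length - 1) + 1 := by omega
      -- the closed box at `s`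
      have h00 : pt.getD ((0 : Fin 8) : ℕ) 0 = D := h0
      have hs0 : s 0 = 1 := by
        have e := ht 0
        rw [h00] at e
        field_simp at e
        linarith
      have hlo : ∀ j : Fin 7, 0 ≤ s j.succ := fun j =>
        (mul_nonneg_iff_of_pos_right hD').mp (by rw [ht]; positivity)
      have hhi : ∀ j : Fin 7, s j.succ ≤ s 0 := fun j => by
        refine le_of_mul_le_mul_right ?_ hD'
        rw [ht, hs0, one_mul]; exact_mod_cast hle j.succ
      have hU0 : (0 : ℝ) < ((cuts.getD 0 0 : ℕ) : ℝ) / E := by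
        have : (0 : ℝ) < ((cuts.getD 0 0 : ℕ) : ℝ) := by exact_mod_cast hA0
        positivity
      have hU : ∀ w < cuts.length - 1, ((cuts.getD w 0 : ℕ) : ℝ) / E ≤ ((cuts.getD (w + 1) 0 : ℕ) : ℝ) / E :=
        fun w hw => div_le_div_of_nonneg_right (by exact_mod_cast sortedLE_spec cuts hsort w (by omega)) hE'.le
      have hpq : ∀ w ≤ cuts.length - 1, (mems.getD w (0, 1)).1 ≠ (mems.getD w (0, 1)).2 :=
        fun w hw => mems_spec hmems (by omega)
      refine ⟨phi30_aOfS_le_winForm s (by rw [hs0]; exact one_pos) hlo hhi _ _ hU0 (hh_of_wallOK hD hE ht hw) hU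
        _ _ hpq, ?_⟩
      rw [← winFormL_eq_winForm s E (cuts.length - 1) cuts mems hcl hml]
      exact winSum_sound hD hE ht h0 hle (MI.mem_logNat2 SC_pos hLD) cuts mems hsort hA0 hlen hall
    · rw [if_neg hall] at h
      simp at h
  · rw [if_neg hchk] at h
    simp at h

/-! ### The final theorems -/

/-- **KERNEL WINDOW BOUND (normalised form).** `winCheck pt D E cuts mems p q = true` and `s_i·D = pt_i` (so `s₀ = 1`,
the closed box) give `Φ(aOfS s) ≤ p/q`. -/
theorem phi30_aOfS_le_of_winCheck {pt : List ℕ} {D E : ℕ} {cuts : List ℕ} {mems : List (Fin 7 × Fin 7)} {p : ℤ}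
    {q : ℕ} (hc : winCheck pt D E cuts mems p q = true) {s : Fin 8 → ℝ}
    (ht : ∀ i : Fin 8, s i * D = ((pt.getD i 0 : ℕ) : ℝ)) : phi30 (aOfS s) ≤ (p : ℝ) / q := by
  simp only [winCheck, Bool.and_eq_true, decide_eq_true_eq] at hc
  obtain ⟨hq, hc⟩ := hc
  split at hc
  · rename_i I hI
    have hc' : I.hi * (q : ℤ) ≤ p * (SC : ℤ) := by simpa using hc
    obtain ⟨h1, h2⟩ := winEnc_sound hI ht
    have hS : (0 : ℝ) < SC := by exact_mod_cast SC_pos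
    have hq' : (0 : ℝ) < q := by exact_mod_cast hq
    have h3 := h2.2
    have h4 : ((I.hi * (q : ℤ) : ℤ) : ℝ) ≤ ((p * (SC : ℤ) : ℤ) : ℝ) := by exact_mod_cast hc'
    push_cast at h4
    have key : (I.hi : ℝ) / SC ≤ (p : ℝ) / q := by rw [div_le_div_iff₀ hS hq']; linarith
    have h5 : winForm s (cuts.length - 1) (fun w => ((cuts.getD w 0 : ℕ) : ℝ) / E)
        (fun w => (mems.getD w (0, 1)).1) (fun w => (mems.getD w (0, 1)).2) ≤ (I.hi : ℝ) / SC := by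
      rw [le_div_iff₀ hS]; exact h3
    linarith
  · simp at hc

/-- **KERNEL WINDOW INTERVAL.** The two-sided check certifies `pl/q ≤ winForm ≤ pu/q` at `s = pt/D`, and
`Φ(aOfS s) ≤ pu/q`. -/
theorem winForm_mem_of_winCheck2 {pt : List ℕ} {D E : ℕ} {cuts : List ℕ} {mems : List (Fin 7 × Fin 7)}
    {pl pu : ℤ} {q : ℕ} (hc : winCheck2 pt D E cuts mems pl pu q = true) {s : Fin 8 → ℝ}
    (ht : ∀ i : Fin 8, s i * D = ((pt.getD i 0 : ℕ) : ℝ)) :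
    (pl : ℝ) / q ≤ winForm s (cuts.length - 1) (fun w => ((cuts.getD w 0 : ℕ) : ℝ) / E)
        (fun w => (mems.getD w (0, 1)).1) (fun w => (mems.getD w (0, 1)).2) ∧
      winForm s (cuts.length - 1) (fun w => ((cuts.getD w 0 : ℕ) : ℝ) / E)
        (fun w => (mems.getD w (0, 1)).1) (fun w => (mems.getD w (0, 1)).2) ≤ (pu : ℝ) / q ∧
      phi30 (aOfS s) ≤ (pu : ℝ) / q := by
  simp only [winCheck2, Bool.and_eq_true, decide_eq_true_eq] at hc
  obtain ⟨hq, hc⟩ := hc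
  split at hc
  · rename_i I hI
    have hc' : pl * (SC : ℤ) ≤ I.lo * (q : ℤ) ∧ I.hi * (q : ℤ) ≤ pu * (SC : ℤ) := by simpa using hc
    obtain ⟨h1, h2⟩ := winEnc_sound hI ht
    have hS : (0 : ℝ) < SC := by exact_mod_cast SC_pos
    have hq' : (0 : ℝ) < q := by exact_mod_cast hq
    have h4 : ((pl * (SC : ℤ) : ℤ) : ℝ) ≤ ((I.lo * (q : ℤ) : ℤ) : ℝ) := by exact_mod_cast hc'.1
    have h5 : ((I.hi * (q : ℤ) : ℤ) : ℝ) ≤ ((pu * (SC : ℤ) : ℤ) : ℝ) := by exact_mod_cast hc'.2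
    push_cast at h4 h5
    have k1 : (pl : ℝ) / q ≤ (I.lo : ℝ) / SC := by rw [div_le_div_iff₀ hq' hS]; linarith
    have k2 : (I.hi : ℝ) / SC ≤ (pu : ℝ) / q := by rw [div_le_div_iff₀ hS hq']; linarith
    have h6 : (I.lo : ℝ) / SC ≤ winForm s (cuts.length - 1) (fun w => ((cuts.getD w 0 : ℕ) : ℝ) / E)
        (fun w => (mems.getD w (0, 1)).1) (fun w => (mems.getD w (0, 1)).2) := by
      rw [div_le_iff₀ hS]; exact h2.1
    have h7 : winForm s (cuts.length - 1) (fun w => ((cuts.getD w 0 : ℕ) : ℝ) / E)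
        (fun w => (mems.getD w (0, 1)).1) (fun w => (mems.getD w (0, 1)).2) ≤ (I.hi : ℝ) / SC := by
      rw [le_div_iff₀ hS]; exact h2.2
    exact ⟨by linarith, by linarith, by linarith⟩
  · simp at hc

/-- **KERNEL WINDOW BOUND FOR Φ.** `winCheck pt D E cuts mems p q = true` ⇒ `Φ(a) ≤ s₀(a)·(p/q)` for EVERY direction `a`
of the closed box with normalised parameters `s_i(a)/s₀(a) = pt_i/D` (P2 g24's `phi30_le_windows_members` at the
normalised direction + `phi30_smul`; cert-2 g33's KERNEL 42-family underneath). -/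
theorem phi30_le_of_winCheck {pt : List ℕ} {D E : ℕ} {cuts : List ℕ} {mems : List (Fin 7 × Fin 7)} {p : ℤ} {q : ℕ}
    (hc : winCheck pt D E cuts mems p q = true) {a : Dir} (ha : BZBox a)
    (ht : ∀ i : Fin 8, sParam a i / sParam a 0 * D = ((pt.getD i 0 : ℕ) : ℝ)) :
    phi30 a ≤ sParam a 0 * ((p : ℝ) / q) := by
  have h0 : 0 < sParam a 0 := ha.1
  have h := phi30_aOfS_le_of_winCheck hc (s := fun i => sParam a i / sParam a 0) ht
  have e : phi30 a = sParam a 0 * phi30 (aOfS fun i => sParam a i / sParam a 0) := by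
    conv_lhs => rw [aOfS_normalise ha]
    rw [phi30_smul h0]
  rw [e]
  exact mul_le_mul_of_nonneg_left h h0.le

/-- **KERNEL WINDOW BOUND FOR Φ from the two-sided check.** -/
theorem phi30_le_of_winCheck2 {pt : List ℕ} {D E : ℕ} {cuts : List ℕ} {mems : List (Fin 7 × Fin 7)} {pl pu : ℤ}
    {q : ℕ} (hc : winCheck2 pt D E cuts mems pl pu q = true) {a : Dir} (ha : BZBox a)
    (ht : ∀ i : Fin 8, sParam a i / sParam a 0 * D = ((pt.getD i 0 : ℕ) : ℝ)) :
    phi30 a ≤ sParam a 0 * ((pu : ℝ) / q) := by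
  have h0 : 0 < sParam a 0 := ha.1
  have h := (winForm_mem_of_winCheck2 hc (s := fun i => sParam a i / sParam a 0) ht).2.2
  have e : phi30 a = sParam a 0 * phi30 (aOfS fun i => sParam a i / sParam a 0) := by
    conv_lhs => rw [aOfS_normalise ha]
    rw [phi30_smul h0]
  rw [e]
  exact mul_le_mul_of_nonneg_left h h0.le

end LemmaFWin

end Summit.KontsevichZagierPeriods.Zeta5Search.Barrier.ConeGamma
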